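import Summits.KontsevichZagierPeriods.KontsevichZagierPeriods.Theorems.RootDecompRationalCubeDichotomySimpleBranchBoxChain

/-!
# Route RootDecompRationalCubeDichotomy — item 27842 `PiRationalisationSimpleBranch` PROVED, part 9/11 (`RootDecompRationalCubeDichotomySimpleBranchS3`)

Theorems-split (≤ 400 lines each, sequential imports) of the decomp-kz lens-2 gen-4 file
`run/shared/lean/pub/decomp-kz/decomp-kz-lens-2/g4/PiRationalisationSimpleBranch27842.lean` (2963 lines; lens farm rc 0, writer re-check
rc 0 audit proof-of-item closed:true, critic g2 by-name probe std axioms, 2026-08-30T05:27:57Z/06:02:52Z). The rung: for simple-branch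
Nash data (`F(x,g) = 0`, `∂_z F(x,g) ≠ 0` on the closed cube) `[π]^K·[s] ∈ relations ⊔ ⟨rational closed-cube sector⟩` for all `K ≥ 1` —
root isolation on rational sub-boxes, the Green band move (planar Stokes inside the four moves), the half winding number ≡ 4[A] ≡ [π],
box rescaling, and `PiTimesSector` (item 26388, landed). The final part closes the ROUTE ITEM by name
(`piRationalisationSimpleBranch_proof`). Sector lemmas are REUSED from the landed rung-24903 file `…PiRationalisationSqrtMoves`.
[Kontsevich–Zagier 2001 §1.2; argument principle] Standard axioms, 0 sorry.
-/

noncomputable section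

set_option linter.dupNamespace false

namespace Summit.KontsevichZagierPeriods.RootDecompRationalCubeDichotomy.Rung27842.SimpleBranch

open MeasureTheory Set MvPolynomial
open Literature.NumberTheory.Transcendental Literature.NumberTheory.Transcendental.KZ
open Literature.ModelTheory.ExponentialFields (IsSemialgebraic)
open Summit.KontsevichZagierPeriods.KontsevichZagierPeriods.Theses.RootDecompRationalCubeDichotomy
  (PiTimesSector PiRationalisationSimpleBranch)
open Summit.KontsevichZagierPeriods.RootDecompRationalCubeDichotomy.Rung27842.RootIso

/-! ### S1 helper lemmas -/

/-- A representation with a continuous `ℚ`-semialgebraic integrand on a compact `ℚ`-semialgebraic domain. -/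
def cRep {k : ℕ} (D : Set (Fin k → ℝ)) (hD : IsSemialgebraic ℚ D) (hDc : IsCompact D)
    (f : (Fin k → ℝ) → ℝ) (hf : IsSemialgebraicFunOn ℚ D f) (hfc : ContinuousOn f D) : IntegralRep k :=
  ⟨D, f, hD, hf, hfc.integrableOn_compact hDc⟩

/-- Auxiliary step `continuous_init'`. [bookkeeping] -/
theorem continuous_init' {m : ℕ} : Continuous (fun z : Fin (m + 1) → ℝ => Fin.init z) :=
  continuous_pi fun _ => continuous_apply _

/-- A band with continuous bounds over a compact base is compact. -/
theorem isCompact_band {m : ℕ} {τ : Set (Fin m → ℝ)} (hτ : IsCompact τ) {α β : (Fin m → ℝ) → ℝ}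
    (hα : ContinuousOn α τ) (hβ : ContinuousOn β τ) : IsCompact (KZlog.band τ α β) := by
  obtain ⟨Cα, hCα⟩ := hτ.exists_bound_of_continuousOn hα
  obtain ⟨Cβ, hCβ⟩ := hτ.exists_bound_of_continuousOn hβ
  obtain ⟨Cτ, hCτ⟩ := isBounded_iff_forall_norm_le.1 hτ.isBounded
  have hA : IsClosed {z : Fin (m + 1) → ℝ | Fin.init z ∈ τ} := hτ.isClosed.preimage continuous_init'
  have hcA : ContinuousOn (fun z : Fin (m + 1) → ℝ => Fin.init z) {z | Fin.init z ∈ τ} :=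
    continuous_init'.continuousOn
  have hc1 : ContinuousOn (fun z : Fin (m + 1) → ℝ => z (Fin.last m) - α (Fin.init z)) {z | Fin.init z ∈ τ} :=
    ((continuous_apply _).continuousOn).sub (hα.comp hcA fun z hz => hz)
  have hc2 : ContinuousOn (fun z : Fin (m + 1) → ℝ => β (Fin.init z) - z (Fin.last m)) {z | Fin.init z ∈ τ} :=
    (hβ.comp hcA fun z hz => hz).sub ((continuous_apply _).continuousOn)
  have h1 := hc1.preimage_isClosed_of_isClosed hA isClosed_Ici (t := Set.Ici (0:ℝ))
  have h2 := hc2.preimage_isClosed_of_isClosed hA isClosed_Ici (t := Set.Ici (0:ℝ))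
  have hclosed : IsClosed (KZlog.band τ α β) := by
    convert h1.inter h2 using 1
    ext z
    simp only [KZlog.band, Set.mem_setOf_eq, Set.mem_inter_iff, Set.mem_preimage, Set.mem_Ici, sub_nonneg]
    tauto
  have hbdd : Bornology.IsBounded (KZlog.band τ α β) := by
    refine isBounded_iff_forall_norm_le.2 ⟨|Cτ| + |Cα| + |Cβ|, fun z hz => ?_⟩
    rcases hz with ⟨hzτ, hzα, hzβ⟩
    refine (pi_norm_le_iff_of_nonneg (by positivity)).2 fun j => ?_
    refine Fin.lastCases ?_ (fun i => ?_) j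
    · have h1 : |z (Fin.last m)| ≤ max |α (Fin.init z)| |β (Fin.init z)| := abs_le_max_abs_abs hzα hzβ
      have h2 : |α (Fin.init z)| ≤ |Cα| := (Real.norm_eq_abs _ ▸ hCα _ hzτ).trans (le_abs_self _)
      have h3 : |β (Fin.init z)| ≤ |Cβ| := (Real.norm_eq_abs _ ▸ hCβ _ hzτ).trans (le_abs_self _)
      rw [Real.norm_eq_abs]
      have : max |α (Fin.init z)| |β (Fin.init z)| ≤ |Cα| + |Cβ| :=
        max_le (h2.trans (le_add_of_nonneg_right (abs_nonneg _))) (h3.trans (le_add_of_nonneg_left (abs_nonneg _)))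
      linarith [abs_nonneg Cτ]
    · have h1 : ‖z (Fin.castSucc i)‖ ≤ ‖Fin.init z‖ := norm_le_pi_norm (Fin.init z) i
      have h2 : ‖Fin.init z‖ ≤ |Cτ| := (hCτ _ hzτ).trans (le_abs_self _)
      linarith [abs_nonneg Cα, abs_nonneg Cβ]
  exact Metric.isCompact_of_isClosed_isBounded hclosed hbdd

/-- Auxiliary step `continuousOn_snoc_fun`. [bookkeeping] -/
theorem continuousOn_snoc_fun {m : ℕ} {s : Set (Fin (m + 1) → ℝ)} {φ : (Fin (m + 1) → ℝ) → ℝ}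
    (hφ : ContinuousOn φ s) : ContinuousOn (fun y : Fin (m + 1) → ℝ => (Fin.snoc y (φ y) : Fin (m + 2) → ℝ)) s := by
  refine continuousOn_pi.2 fun j => ?_
  refine Fin.lastCases ?_ (fun i => ?_) j
  · simp only [Fin.snoc_last]; exact hφ
  · simp only [Fin.snoc_castSucc]; exact (continuous_apply i).continuousOn

/-- Auxiliary step `continuousOn_snoc_snoc_fun`. [bookkeeping] -/
theorem continuousOn_snoc_snoc_fun {m : ℕ} {s : Set (Fin (m + 1) → ℝ)} {φ : (Fin (m + 1) → ℝ) → ℝ}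
    (hφ : ContinuousOn φ s) :
    ContinuousOn (fun y : Fin (m + 1) → ℝ =>
      (Fin.snoc (Fin.snoc (Fin.init y) (φ y) : Fin (m + 1) → ℝ) (y (Fin.last m)) : Fin (m + 2) → ℝ)) s := by
  refine continuousOn_pi.2 fun j => ?_
  refine Fin.lastCases ?_ (fun j' => ?_) j
  · simp only [Fin.snoc_last]; exact (continuous_apply _).continuousOn
  · refine Fin.lastCases ?_ (fun i => ?_) j'
    · simp only [Fin.snoc_castSucc, Fin.snoc_last]; exact hφ
    · simp only [Fin.snoc_castSucc]; exact (continuous_apply _).continuousOn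

/-- Auxiliary step `isSemialgebraicMapOn_snoc_fun`. [bookkeeping] -/
theorem isSemialgebraicMapOn_snoc_fun {m : ℕ} {s : Set (Fin (m + 1) → ℝ)} (hs : IsSemialgebraic ℚ s)
    {φ : (Fin (m + 1) → ℝ) → ℝ} (hφ : IsSemialgebraicFunOn ℚ s φ) :
    IsSemialgebraicMapOn ℚ s (fun y : Fin (m + 1) → ℝ => (Fin.snoc y (φ y) : Fin (m + 2) → ℝ)) := by
  refine IsSemialgebraicMapOn.of_forall hs fun j => ?_
  refine Fin.lastCases ?_ (fun i => ?_) j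
  · exact hφ.congr (fun y _ => by simp)
  · exact (isSemialgebraicFunOn_apply hs i).congr (fun y _ => by simp)

/-- Auxiliary step `isSemialgebraicMapOn_snoc_snoc_fun`. [bookkeeping] -/
theorem isSemialgebraicMapOn_snoc_snoc_fun {m : ℕ} {s : Set (Fin (m + 1) → ℝ)} (hs : IsSemialgebraic ℚ s)
    {φ : (Fin (m + 1) → ℝ) → ℝ} (hφ : IsSemialgebraicFunOn ℚ s φ) :
    IsSemialgebraicMapOn ℚ s (fun y : Fin (m + 1) → ℝ =>
      (Fin.snoc (Fin.snoc (Fin.init y) (φ y) : Fin (m + 1) → ℝ) (y (Fin.last m)) : Fin (m + 2) → ℝ)) := by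
  refine IsSemialgebraicMapOn.of_forall hs fun j => ?_
  refine Fin.lastCases ?_ (fun j' => ?_) j
  · exact (isSemialgebraicFunOn_apply hs (Fin.last m)).congr (fun y _ => by simp)
  · refine Fin.lastCases ?_ (fun i => ?_) j'
    · exact hφ.congr (fun y _ => by simp)
    · exact (isSemialgebraicFunOn_apply hs (Fin.castSucc i)).congr (fun y _ => by simp [Fin.init])

/-- `y ↦ Im(N/D)(snoc y (φ y))` is semialgebraic where `D ≠ 0`. -/
theorem sa_Im {m : ℕ} (N D : MvPolynomial (Fin (m + 1)) ℚ) {s : Set (Fin (m + 1) → ℝ)} (hs : IsSemialgebraic ℚ s)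
    {φ : (Fin (m + 1) → ℝ) → ℝ} (hφ : IsSemialgebraicFunOn ℚ s φ)
    (hD : ∀ y ∈ s, aeval (ReIm.cplxPoint (Fin.snoc y (φ y) : Fin (m + 2) → ℝ)) D ≠ 0) :
    IsSemialgebraicFunOn ℚ s (fun y => ReIm.ratIm N D (Fin.snoc y (φ y))) :=
  IsSemialgebraicFunOn.comp_isSemialgebraicMapOn_holds
    (ReIm.isSemialgebraicFunOn_ratIm N D (ReIm.isSemialgebraic_setOf_cplx_ne D) (fun _ hW => hW))
    (isSemialgebraicMapOn_snoc_fun hs hφ) (fun y hy => hD y hy)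

/-- Auxiliary step `co_Im`. [bookkeeping] -/
theorem co_Im {m : ℕ} (N D : MvPolynomial (Fin (m + 1)) ℚ) {s : Set (Fin (m + 1) → ℝ)}
    {φ : (Fin (m + 1) → ℝ) → ℝ} (hφ : ContinuousOn φ s)
    (hD : ∀ y ∈ s, aeval (ReIm.cplxPoint (Fin.snoc y (φ y) : Fin (m + 2) → ℝ)) D ≠ 0) :
    ContinuousOn (fun y => ReIm.ratIm N D (Fin.snoc y (φ y))) s :=
  (ReIm.continuousOn_ratIm N D (s := (fun y : Fin (m + 1) → ℝ => (Fin.snoc y (φ y) : Fin (m + 2) → ℝ)) '' s)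
    (by rintro _ ⟨y, hy, rfl⟩; exact hD y hy)).comp (continuousOn_snoc_fun hφ) (Set.mapsTo_image _ _)

/-- `y ↦ Re(N/D)(snoc (snoc (init y) (φ y)) (y last))` is semialgebraic where `D ≠ 0`. -/
theorem sa_Re {m : ℕ} (N D : MvPolynomial (Fin (m + 1)) ℚ) {s : Set (Fin (m + 1) → ℝ)} (hs : IsSemialgebraic ℚ s)
    {φ : (Fin (m + 1) → ℝ) → ℝ} (hφ : IsSemialgebraicFunOn ℚ s φ)
    (hD : ∀ y ∈ s, aeval (ReIm.cplxPoint
      (Fin.snoc (Fin.snoc (Fin.init y) (φ y) : Fin (m + 1) → ℝ) (y (Fin.last m)) : Fin (m + 2) → ℝ)) D ≠ 0) :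
    IsSemialgebraicFunOn ℚ s (fun y => ReIm.ratRe N D
      (Fin.snoc (Fin.snoc (Fin.init y) (φ y) : Fin (m + 1) → ℝ) (y (Fin.last m)))) :=
  IsSemialgebraicFunOn.comp_isSemialgebraicMapOn_holds
    (ReIm.isSemialgebraicFunOn_ratRe N D (ReIm.isSemialgebraic_setOf_cplx_ne D) (fun _ hW => hW))
    (isSemialgebraicMapOn_snoc_snoc_fun hs hφ) (fun y hy => hD y hy)

/-- Auxiliary step `co_Re`. [bookkeeping] -/
theorem co_Re {m : ℕ} (N D : MvPolynomial (Fin (m + 1)) ℚ) {s : Set (Fin (m + 1) → ℝ)}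
    {φ : (Fin (m + 1) → ℝ) → ℝ} (hφ : ContinuousOn φ s)
    (hD : ∀ y ∈ s, aeval (ReIm.cplxPoint
      (Fin.snoc (Fin.snoc (Fin.init y) (φ y) : Fin (m + 1) → ℝ) (y (Fin.last m)) : Fin (m + 2) → ℝ)) D ≠ 0) :
    ContinuousOn (fun y => ReIm.ratRe N D
      (Fin.snoc (Fin.snoc (Fin.init y) (φ y) : Fin (m + 1) → ℝ) (y (Fin.last m)))) s :=
  (ReIm.continuousOn_ratRe N D
    (s := (fun y : Fin (m + 1) → ℝ =>
      (Fin.snoc (Fin.snoc (Fin.init y) (φ y) : Fin (m + 1) → ℝ) (y (Fin.last m)) : Fin (m + 2) → ℝ)) '' s)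
    (by rintro _ ⟨y, hy, rfl⟩; exact hD y hy)).comp (continuousOn_snoc_snoc_fun hφ) (Set.mapsTo_image _ _)

/-- Integrand additivity, packaged. -/
theorem rel_add {m : ℕ} (r r₁ r₂ : IntegralRep m) (h1 : r₁.domain = r.domain) (h2 : r₂.domain = r.domain)
    (h : ∀ z ∈ r.domain, r.integrand z = r₁.integrand z + r₂.integrand z) : of r - of r₁ - of r₂ ∈ relations :=
  integrandAddRel_subset_relations ⟨m, r, r₁, r₂, h1, h2, fun z hz => by simpa only [Pi.add_apply] using h z hz, rfl⟩

/-- Fibre splitting of a band at an intermediate semialgebraic function (domain additivity; the common graph is null). -/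
theorem fibre_split {m : ℕ} (R : IntegralRep (m + 1)) {τ : Set (Fin m → ℝ)} {α μ β : (Fin m → ℝ) → ℝ}
    (hR : R.domain = KZlog.band τ α β) (hα : IsSemialgebraicFunOn ℚ τ α) (hμ : IsSemialgebraicFunOn ℚ τ μ)
    (hβ : IsSemialgebraicFunOn ℚ τ β) (hαμ : ∀ x ∈ τ, α x ≤ μ x) (hμβ : ∀ x ∈ τ, μ x ≤ β x) :
    ∃ R₁ R₂ : IntegralRep (m + 1), R₁.domain = KZlog.band τ α μ ∧ R₁.integrand = R.integrand ∧
      R₂.domain = KZlog.band τ μ β ∧ R₂.integrand = R.integrand ∧ of R - of R₁ - of R₂ ∈ relations := by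
  have hs1 : KZlog.band τ α μ ⊆ R.domain := by
    rw [hR]; rintro z ⟨h1, h2, h3⟩; exact ⟨h1, h2, h3.trans (hμβ _ h1)⟩
  have hs2 : KZlog.band τ μ β ⊆ R.domain := by
    rw [hR]; rintro z ⟨h1, h2, h3⟩; exact ⟨h1, (hαμ _ h1).trans h2, h3⟩
  refine ⟨R.restrict _ (KZlog.isSemialgebraic_band hα hμ) hs1, R.restrict _ (KZlog.isSemialgebraic_band hμ hβ) hs2,
    rfl, rfl, rfl, rfl, ?_⟩
  refine domainAddRel_subset_relations ⟨m + 1, R, R.restrict _ (KZlog.isSemialgebraic_band hα hμ) hs1,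
    R.restrict _ (KZlog.isSemialgebraic_band hμ hβ) hs2, ?_, ?_, fun _ _ => rfl, fun _ _ => rfl, rfl⟩
  · show R.domain = KZlog.band τ α μ ∪ KZlog.band τ μ β
    rw [hR]; ext z
    simp only [KZlog.band, Set.mem_setOf_eq, Set.mem_union]
    constructor
    · rintro ⟨h1, h2, h3⟩
      rcases le_total (z (Fin.last m)) (μ (Fin.init z)) with h | h
      · exact Or.inl ⟨h1, h2, h⟩
      · exact Or.inr ⟨h1, h, h3⟩
    · rintro (⟨h1, h2, h3⟩ | ⟨h1, h2, h3⟩)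
      · exact ⟨h1, h2, h3.trans (hμβ _ h1)⟩
      · exact ⟨h1, (hαμ _ h1).trans h2, h3⟩
  · show MeasureTheory.volume (KZlog.band τ α μ ∩ KZlog.band τ μ β) = 0
    refine MeasureTheory.measure_mono_null ?_ (volume_graph_eq_zero hμ)
    rintro z ⟨⟨h1, -, h3⟩, ⟨-, h2, -⟩⟩
    exact ⟨h1, le_antisymm h3 h2⟩

end Summit.KontsevichZagierPeriods.RootDecompRationalCubeDichotomy.Rung27842.SimpleBranch
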